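import Mathlib.Analysis.SpecialFunctions.OrdinaryHypergeometric
import Mathlib.Analysis.Calculus.SmoothSeries
import Mathlib.Analysis.Calculus.Deriv.Pow
import Mathlib.Analysis.Complex.CauchyIntegral
import HarnessLib

/-!
# Gauss's hypergeometric function `₂F₁(a, b; c; z)` with complex parameters inside the unit
# disc: coefficient recursion, the derivative formula, and the hypergeometric equation

Mathlib (`Mathlib/Analysis/SpecialFunctions/OrdinaryHypergeometric.lean`) defines
`ordinaryHypergeometric a b c = ₂F₁ a b c` as the sum of the formal power series with
coefficients `αₙ = (a)ₙ(b)ₙ/((c)ₙ n!)` and proves that its radius of convergence is `1` (or `⊤`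
when the series terminates), but has no derivative and no differential equation. The tree has
the REAL-parameter calculus (`Literature.NumberTheory.Automorphic.LegendreP.hasDerivAt_ordinaryHypergeometric`,
`Literature.NumberTheory.ModularForms.ordinaryHypergeometric_ode`, real `a b c x`). This file
does the COMPLEX case `a b c z : ℂ`, `‖z‖ < 1`, which is what the near-extremal Kerr throat
equation needs (`Literature/Geometry/Lorentzian/NearExtremalThroatHypergeometric.lean`:
`a, b = ½ − i(2ξ − m̂) ∓ iδ`, `c = 1 − 2iξ`):

* `one_le_radius`, `hasSum_coeff_mul_pow` — the series converges (absolutely) to `₂F₁ a b c z`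
  on `‖z‖ < 1` for ALL complex parameters;
* `succ_mul_coeff_succ` — `(n+1) αₙ₊₁(a,b,c) = (ab/c) αₙ(a+1,b+1,c+1)` (no hypothesis; both
  sides are junk `0` together under Mathlib's `0⁻¹ = 0`), and `coeff_succ_rec` — the recursion
  `(n+1)(c+n) αₙ₊₁ = (a+n)(b+n) αₙ` for `c + n ≠ 0`;
* `hasDerivAt_ordinaryHypergeometric` — **DLMF 15.5.1**:
  `d/dz ₂F₁(a,b;c;z) = (ab/c) ₂F₁(a+1,b+1;c+1;z)` on `‖z‖ < 1` (termwise differentiation,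
  `hasDerivAt_tsum_of_isPreconnected`), hence differentiability/analyticity on the disc;
* `ode_of_hasSum` — the generic fact that a power series whose coefficients satisfy the
  hypergeometric recursion solves `z(1−z)F'' + (c − (a+b+1)z)F' − abF = 0`, and
  `ordinaryHypergeometric_ode` — **DLMF 15.10.1** for `₂F₁ a b c` on `‖z‖ < 1` when `c ∉ −ℕ`,
  with the explicit derivatives `f' = (ab/c)₂F₁(a+1,b+1;c+1;·)`,
  `f'' = (ab/c)((a+1)(b+1)/(c+1))₂F₁(a+2,b+2;c+2;·)`; `ordinaryHypergeometric_ode_hasDerivAt`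
  packages the two `HasDerivAt` facts with the equation (pointwise house style);
* `ordinaryHypergeometric_neg_ofReal_ode` — the real-variable corollary in the variable
  `z = −x`, `|x| < 1`: `g x := ₂F₁ a b c (−x)` satisfies
  `x(1+x)g'' + (c + (a+b+1)x)g' + ab·g = 0` with `g'(x) = −f'(−x)`, `g''(x) = f''(−x)` — exactly
  the hypothesis shape consumed by `Kerr.TeukolskyPress.throatSolution_of_hypergeometric`.

Why `c ∉ −ℕ` is needed for the equation: for `c = −m` Mathlib's coefficients are the junk value
`0` from `n = m + 1` on, so `₂F₁ a b (−m)` is a polynomial which does not solve the equation in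
general. No hypothesis on `a, b` (terminating series are fine). Continuation beyond the disc
(Euler's integral, DLMF 15.6.1) is in `HypergeometricEulerIntegral.lean`; nothing here is
asymptotic.

References: NIST DLMF §15.2, (15.5.1), (15.10.1) [DLMF]; G. E. Andrews, R. Askey, R. Roy,
*Special Functions* (1999), (2.1.2), Thm 2.2.1, (2.3.5), (2.5.1) [AndrewsAskeyRoy1999].
-/

noncomputable section

open FormalMultilinearSeries Filter Metric
open scoped Topology Nat

namespace Literature.Analysis.SpecialFunctions.Hypergeometric

/-! ### A power series with hypergeometric coefficients solves the hypergeometric equation -/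

section PowerSeries

variable {A : ℕ → ℂ}

/-- **The hypergeometric differential equation from the coefficient recurrence** (complex
version): if `(n+1)(n+c) Aₙ₊₁ = (n+a)(n+b) Aₙ` for all `n` and `F₀ = Σ Aₙzⁿ`,
`F₁ = Σ (n+1)Aₙ₊₁zⁿ`, `F₂ = Σ (n+1)(n+2)Aₙ₊₂zⁿ` (the series and its two termwise derivatives
at `z`), then `z(1−z)F₂ + [c − (a+b+1)z]F₁ − abF₀ = 0`. [cite: DLMF, 15.10.1] -/
theorem ode_of_hasSum {a b c z F₀ F₁ F₂ : ℂ}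
    (hrec : ∀ n : ℕ, ((n : ℂ) + 1) * ((n : ℂ) + c) * A (n + 1) = ((n : ℂ) + a) * ((n : ℂ) + b) * A n)
    (h₀ : HasSum (fun n : ℕ => A n * z ^ n) F₀)
    (h₁ : HasSum (fun n : ℕ => ((n : ℂ) + 1) * A (n + 1) * z ^ n) F₁)
    (h₂ : HasSum (fun n : ℕ => ((n : ℂ) + 1) * ((n : ℂ) + 2) * A (n + 2) * z ^ n) F₂) :
    z * (1 - z) * F₂ + (c - (a + b + 1) * z) * F₁ - a * b * F₀ = 0 := by
  -- realign `z F₂`, `z² F₂` and `z F₁` on the powers `z ^ m`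
  set U : ℕ → ℂ := fun m => (m : ℂ) * ((m : ℂ) + 1) * A (m + 1) * z ^ m with hU_def
  set V : ℕ → ℂ := fun m => ((m : ℂ) - 1) * (m : ℂ) * A m * z ^ m with hV_def
  set W : ℕ → ℂ := fun m => (m : ℂ) * A m * z ^ m with hW_def
  have hU' : HasSum (fun n => U (n + 1)) (z * F₂) := by
    have e : (fun n : ℕ => U (n + 1)) =
        fun n : ℕ => z * (((n : ℂ) + 1) * ((n : ℂ) + 2) * A (n + 2) * z ^ n) := by
      funext n
      rw [show n + 1 + 1 = n + 2 from rfl]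
      simp only [hU_def, Nat.cast_add, Nat.cast_one, pow_succ]
      ring
    rw [e]; exact h₂.mul_left z
  have hU : HasSum U (z * F₂) := by
    have h := (hasSum_nat_add_iff 1).mp hU'
    simpa [hU_def] using h
  have hV' : HasSum (fun n => V (n + 2)) (z ^ 2 * F₂) := by
    have e : (fun n : ℕ => V (n + 2)) =
        fun n : ℕ => z ^ 2 * (((n : ℂ) + 1) * ((n : ℂ) + 2) * A (n + 2) * z ^ n) := by
      funext n
      simp only [hV_def, Nat.cast_add, Nat.cast_ofNat, pow_add]
      ring
    rw [e]; exact h₂.mul_left (z ^ 2)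
  have hV : HasSum V (z ^ 2 * F₂) := by
    have h := (hasSum_nat_add_iff 2).mp hV'
    simpa [hV_def, Finset.sum_range_succ] using h
  have hW' : HasSum (fun n => W (n + 1)) (z * F₁) := by
    have e : (fun n : ℕ => W (n + 1)) =
        fun n : ℕ => z * (((n : ℂ) + 1) * A (n + 1) * z ^ n) := by
      funext n
      simp only [hW_def, Nat.cast_add, Nat.cast_one, pow_succ]
      ring
    rw [e]; exact h₁.mul_left z
  have hW : HasSum W (z * F₁) := by
    have h := (hasSum_nat_add_iff 1).mp hW'
    simpa [hW_def] using h
  have htot := (((hU.sub hV).add (h₁.mul_left c)).sub (hW.mul_left (a + b + 1))).sub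
    (h₀.mul_left (a * b))
  have hzero : (fun m : ℕ => U m - V m + c * (((m : ℂ) + 1) * A (m + 1) * z ^ m) -
      (a + b + 1) * W m - a * b * (A m * z ^ m)) = fun _ => 0 := by
    funext m
    have := hrec m
    simp only [hU_def, hV_def, hW_def]
    linear_combination (z ^ m) * this
  rw [hzero] at htot
  have := htot.unique hasSum_zero
  linear_combination this

end PowerSeries

/-! ### The coefficients and the series on the unit disc -/

section Coefficients

variable (a b c : ℂ)

/-- The radius of convergence of the complex hypergeometric series `₂F₁(a,b;c;·)` is at least
`1` for ALL parameters (Mathlib: `= 1` when no parameter is a non-positive integer, `= ⊤`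
otherwise). [cite: DLMF, 15.2.1] -/
theorem one_le_radius : 1 ≤ (ordinaryHypergeometricSeries ℂ a b c).radius := by
  by_cases h : ∀ kn : ℕ, (kn : ℂ) ≠ -a ∧ (kn : ℂ) ≠ -b ∧ (kn : ℂ) ≠ -c
  · rw [ordinaryHypergeometricSeries_radius_eq_one ℂ a b c h]
  · push Not at h
    obtain ⟨k, hk⟩ := h
    by_cases ha : (k : ℂ) = -a
    · obtain rfl : a = -(k : ℂ) := by rw [ha, neg_neg]
      rw [ordinaryHypergeometric_radius_top_of_neg_nat₁]; exact le_top
    by_cases hb : (k : ℂ) = -b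
    · obtain rfl : b = -(k : ℂ) := by rw [hb, neg_neg]
      rw [ordinaryHypergeometric_radius_top_of_neg_nat₂]; exact le_top
    · obtain rfl : c = -(k : ℂ) := by rw [hk ha hb, neg_neg]
      rw [ordinaryHypergeometric_radius_top_of_neg_nat₃]; exact le_top

/-- `₂F₁(a,b;c;z) = Σₙ αₙ zⁿ` with `αₙ = (a)ₙ(b)ₙ/((c)ₙ n!)` (Mathlib's
`ordinaryHypergeometricCoefficient`), as complex `tsum`s (both sides junk `0` where the series
diverges). [cite: DLMF, 15.2.1] -/
theorem eq_tsum (z : ℂ) :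
    ₂F₁ a b c z = ∑' n : ℕ, ordinaryHypergeometricCoefficient a b c n * z ^ n := by
  rw [ordinaryHypergeometric, ordinaryHypergeometric_sum_eq]
  rfl

/-- The operator norm of the `n`-th term of the hypergeometric formal series is `‖αₙ‖`.
[folklore] -/
theorem norm_series (n : ℕ) :
    ‖ordinaryHypergeometricSeries ℂ a b c n‖ = ‖ordinaryHypergeometricCoefficient a b c n‖ := by
  rw [ordinaryHypergeometricSeries, ofScalars_norm]

/-- Absolute convergence strictly inside the unit disc: `Σ ‖αₙ‖ rⁿ < ∞` for `0 ≤ r < 1`.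
[cite: DLMF, 15.2.1] -/
theorem summable_norm_coeff_mul_pow {r : ℝ} (hr0 : 0 ≤ r) (hr1 : r < 1) :
    Summable fun n : ℕ => ‖ordinaryHypergeometricCoefficient a b c n‖ * r ^ n := by
  lift r to NNReal using hr0
  have h : (r : ENNReal) < (ordinaryHypergeometricSeries ℂ a b c).radius :=
    lt_of_lt_of_le (by exact_mod_cast hr1) (one_le_radius a b c)
  refine ((ordinaryHypergeometricSeries ℂ a b c).summable_norm_mul_pow h).congr fun n => ?_
  rw [norm_series]

variable {a b c}

/-- The hypergeometric series converges at every `‖z‖ < 1`. [cite: DLMF, 15.2.1] -/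
theorem summable_coeff_mul_pow {z : ℂ} (hz : ‖z‖ < 1) :
    Summable fun n : ℕ => ordinaryHypergeometricCoefficient a b c n * z ^ n :=
  .of_norm <| by
    simpa only [norm_mul, norm_pow] using summable_norm_coeff_mul_pow a b c (norm_nonneg z) hz

/-- For `‖z‖ < 1` the hypergeometric series sums to `₂F₁(a,b;c;z)`. [cite: DLMF, 15.2.1] -/
theorem hasSum_coeff_mul_pow {z : ℂ} (hz : ‖z‖ < 1) :
    HasSum (fun n : ℕ => ordinaryHypergeometricCoefficient a b c n * z ^ n) (₂F₁ a b c z) := by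
  rw [eq_tsum]
  exact (summable_coeff_mul_pow hz).hasSum

variable (a b c)

/-- The coefficient identity behind DLMF 15.5.1:
`(n+1) αₙ₊₁(a,b,c) = (ab/c) αₙ(a+1,b+1,c+1)` (no hypothesis: with `c = 0` or `(c+1)ₙ = 0`
both sides vanish under `0⁻¹ = 0`). [cite: DLMF, 15.5.1] -/
theorem succ_mul_coeff_succ (n : ℕ) :
    ((n : ℂ) + 1) * ordinaryHypergeometricCoefficient a b c (n + 1) =
      a * b / c * ordinaryHypergeometricCoefficient (a + 1) (b + 1) (c + 1) n := by
  have hn : ((n : ℂ) + 1) * ((n : ℂ) + 1)⁻¹ = 1 := mul_inv_cancel₀ (Nat.cast_add_one_ne_zero n)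
  simp only [ordinaryHypergeometricCoefficient, ascPochhammer_succ_left, Polynomial.eval_mul,
    Polynomial.eval_X, Polynomial.eval_comp, Polynomial.eval_add, Polynomial.eval_one,
    Nat.factorial_succ, Nat.cast_mul, Nat.cast_add, Nat.cast_one, mul_inv]
  linear_combination (a * b * c⁻¹ * (((n ! : ℕ) : ℂ)⁻¹ *
    Polynomial.eval (a + 1) (ascPochhammer ℂ n) * Polynomial.eval (b + 1) (ascPochhammer ℂ n) *
    (Polynomial.eval (c + 1) (ascPochhammer ℂ n))⁻¹)) * hn

/-- **The coefficient recursion** of the hypergeometric series: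
`(n+1)(c+n) αₙ₊₁ = (a+n)(b+n) αₙ` whenever `c + n ≠ 0`. [cite: DLMF, 15.2.1] -/
theorem coeff_succ_rec (n : ℕ) (hc : c + n ≠ 0) :
    ((n : ℂ) + 1) * (c + n) * ordinaryHypergeometricCoefficient a b c (n + 1) =
      (a + n) * (b + n) * ordinaryHypergeometricCoefficient a b c n := by
  have hn : ((n : ℂ) + 1) * ((n : ℂ) + 1)⁻¹ = 1 := mul_inv_cancel₀ (Nat.cast_add_one_ne_zero n)
  have hc' : (c + n) * (c + n)⁻¹ = 1 := mul_inv_cancel₀ hc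
  simp only [ordinaryHypergeometricCoefficient, ascPochhammer_succ_eval, Nat.factorial_succ,
    Nat.cast_mul, Nat.cast_add, Nat.cast_one, mul_inv]
  linear_combination ((a + n) * (b + n) * (((n ! : ℕ) : ℂ)⁻¹ *
    Polynomial.eval a (ascPochhammer ℂ n) * Polynomial.eval b (ascPochhammer ℂ n) *
    (Polynomial.eval c (ascPochhammer ℂ n))⁻¹)) * ((c + n) * (c + n)⁻¹ * hn + hc')

end Coefficients

/-! ### The derivative formula (DLMF 15.5.1) -/

section Calculus

variable {a b c : ℂ}

/-- The termwise derivative of the hypergeometric series sums to `(ab/c) ₂F₁(a+1,b+1;c+1;z)`: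
`Σ (n+1) αₙ₊₁ zⁿ = (ab/c) ₂F₁(a+1,b+1;c+1;z)` for `‖z‖ < 1`. [cite: DLMF, 15.5.1] -/
theorem hasSum_succ_coeff {z : ℂ} (hz : ‖z‖ < 1) :
    HasSum (fun n : ℕ => ((n : ℂ) + 1) * ordinaryHypergeometricCoefficient a b c (n + 1) * z ^ n)
      (a * b / c * ₂F₁ (a + 1) (b + 1) (c + 1) z) := by
  have h := (hasSum_coeff_mul_pow (a := a + 1) (b := b + 1) (c := c + 1) hz).mul_left (a * b / c)
  refine h.congr_fun fun n => ?_
  rw [succ_mul_coeff_succ, mul_assoc]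

/-- The second termwise derivative: `Σ (n+1)(n+2) αₙ₊₂ zⁿ = (ab/c)((a+1)(b+1)/(c+1)) ₂F₁(a+2,b+2;c+2;z)`
for `‖z‖ < 1`. [cite: DLMF, 15.5.2] -/
theorem hasSum_succ_succ_coeff {z : ℂ} (hz : ‖z‖ < 1) :
    HasSum (fun n : ℕ => ((n : ℂ) + 1) * ((n : ℂ) + 2) *
        ordinaryHypergeometricCoefficient a b c (n + 2) * z ^ n)
      (a * b / c * ((a + 1) * (b + 1) / (c + 1) * ₂F₁ (a + 2) (b + 2) (c + 2) z)) := by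
  have h := (hasSum_succ_coeff (a := a + 1) (b := b + 1) (c := c + 1) hz).mul_left (a * b / c)
  rw [show a + 2 = a + 1 + 1 by ring, show b + 2 = b + 1 + 1 by ring, show c + 2 = c + 1 + 1 by ring]
  refine h.congr_fun fun n => ?_
  have e := succ_mul_coeff_succ a b c (n + 1)
  push_cast at e
  rw [show n + 2 = n + 1 + 1 from rfl]
  linear_combination ((n : ℂ) + 1) * z ^ n * e

/-- **Termwise differentiation of a complex power series** strictly inside a disc on which the
differentiated coefficients are absolutely summable: if `Σ ‖Aₙ₊₁‖ (n+1) rⁿ < ∞` then for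
`‖z‖ < r`, `(Σ Aₙ wⁿ)' (z) = Σ (n+1) Aₙ₊₁ zⁿ`. [folklore] -/
theorem hasDerivAt_tsum_mul_pow {A : ℕ → ℂ} {r : ℝ}
    (hu : Summable fun n : ℕ => ‖A (n + 1)‖ * ((n : ℝ) + 1) * r ^ n) {z : ℂ} (hz : ‖z‖ < r) :
    HasDerivAt (fun w : ℂ => ∑' n : ℕ, A n * w ^ n)
      (∑' n : ℕ, ((n : ℂ) + 1) * A (n + 1) * z ^ n) z := by
  have hr0 : 0 < r := (norm_nonneg z).trans_lt hz
  have hu' : Summable fun n : ℕ => ‖A n‖ * n * r ^ (n - 1) := by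
    rw [← summable_nat_add_iff 1]
    simpa only [Nat.add_sub_cancel, Nat.cast_add, Nat.cast_one] using hu
  have hg : ∀ (n : ℕ) (w : ℂ), w ∈ ball (0 : ℂ) r →
      HasDerivAt (fun w => A n * w ^ n) (A n * ((n : ℂ) * w ^ (n - 1))) w :=
    fun n w _ => (hasDerivAt_pow n w).const_mul (A n)
  have hg' : ∀ (n : ℕ) (w : ℂ), w ∈ ball (0 : ℂ) r →
      ‖A n * ((n : ℂ) * w ^ (n - 1))‖ ≤ ‖A n‖ * n * r ^ (n - 1) := by
    intro n w hw
    rw [mem_ball_zero_iff] at hw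
    rw [norm_mul (A n), norm_mul (n : ℂ), norm_pow, Complex.norm_natCast, ← mul_assoc]
    gcongr
  have h0 : Summable fun n : ℕ => A n * (0 : ℂ) ^ n := by
    refine summable_of_ne_finset_zero (s := {0}) fun n hn => ?_
    rw [Finset.mem_singleton] at hn
    simp [hn]
  have hmain := hasDerivAt_tsum_of_isPreconnected hu' isOpen_ball
    (convex_ball (0 : ℂ) r).isPreconnected hg hg' (mem_ball_self hr0) h0 (mem_ball_zero_iff.2 hz)
  refine hmain.congr_deriv ?_
  have hs : Summable fun n : ℕ => A n * ((n : ℂ) * z ^ (n - 1)) :=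
    .of_norm_bounded hu' fun n => hg' n z (mem_ball_zero_iff.2 hz)
  rw [hs.tsum_eq_zero_add]
  simp only [Nat.cast_zero, zero_mul, mul_zero, zero_add, Nat.add_sub_cancel, Nat.cast_add,
    Nat.cast_one]
  exact tsum_congr fun n => by ring

/-- **DLMF 15.5.1**: `d/dz ₂F₁(a,b;c;z) = (ab/c) ₂F₁(a+1,b+1;c+1;z)` for complex parameters and
`‖z‖ < 1` (termwise differentiation of the power series strictly inside its disc of
convergence). [cite: DLMF, 15.5.1] -/
theorem hasDerivAt_ordinaryHypergeometric {z : ℂ} (hz : ‖z‖ < 1) :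
    HasDerivAt (₂F₁ a b c) (a * b / c * ₂F₁ (a + 1) (b + 1) (c + 1) z) z := by
  obtain ⟨r, hzr, hr1⟩ := exists_between hz
  have hr0 : 0 < r := (norm_nonneg z).trans_lt hzr
  -- the differentiated coefficients are `(ab/c)` times those of `₂F₁(a+1,b+1;c+1;·)`
  have hu : Summable fun n : ℕ =>
      ‖ordinaryHypergeometricCoefficient a b c (n + 1)‖ * ((n : ℝ) + 1) * r ^ n := by
    have hs := (summable_norm_coeff_mul_pow (a + 1) (b + 1) (c + 1) hr0.le hr1).mul_left
      ‖a * b / c‖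
    refine hs.congr fun n => ?_
    have e := congrArg (fun w : ℂ => ‖w‖) (succ_mul_coeff_succ a b c n)
    have en : ‖((n : ℂ) + 1)‖ = (n : ℝ) + 1 := by
      rw [show ((n : ℂ) + 1) = ((n + 1 : ℕ) : ℂ) by push_cast; ring, Complex.norm_natCast]
      push_cast; ring
    rw [norm_mul ((n : ℂ) + 1), norm_mul (a * b / c), en] at e
    rw [← mul_assoc, ← e]
    ring
  have hmain := hasDerivAt_tsum_mul_pow hu hzr
  have hfun : (fun w : ℂ => ∑' n : ℕ, ordinaryHypergeometricCoefficient a b c n * w ^ n) =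
      ₂F₁ a b c := by
    funext w; rw [eq_tsum]
  rw [hfun] at hmain
  exact hmain.congr_deriv (hasSum_succ_coeff hz).tsum_eq

/-- `deriv` form of DLMF 15.5.1. [cite: DLMF, 15.5.1] -/
theorem deriv_ordinaryHypergeometric {z : ℂ} (hz : ‖z‖ < 1) :
    deriv (₂F₁ a b c) z = a * b / c * ₂F₁ (a + 1) (b + 1) (c + 1) z :=
  (hasDerivAt_ordinaryHypergeometric hz).deriv

variable (a b c)

/-- `₂F₁(a,b;c;·)` is complex-differentiable on the open unit disc. [cite: DLMF, 15.2(i)] -/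
theorem differentiableOn_ordinaryHypergeometric :
    DifferentiableOn ℂ (₂F₁ a b c : ℂ → ℂ) (ball 0 1) := fun _ hz =>
  (hasDerivAt_ordinaryHypergeometric (mem_ball_zero_iff.1 hz)).differentiableAt.differentiableWithinAt

/-- `₂F₁(a,b;c;·)` is analytic on the open unit disc. [cite: DLMF, 15.2(i)] -/
theorem analyticOnNhd_ordinaryHypergeometric :
    AnalyticOnNhd ℂ (₂F₁ a b c : ℂ → ℂ) (ball 0 1) :=
  (differentiableOn_ordinaryHypergeometric a b c).analyticOnNhd isOpen_ball

/-- `₂F₁(a,b;c;·)` is continuous on the open unit disc. [cite: DLMF, 15.2(i)] -/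
theorem continuousOn_ordinaryHypergeometric :
    ContinuousOn (₂F₁ a b c : ℂ → ℂ) (ball 0 1) :=
  (differentiableOn_ordinaryHypergeometric a b c).continuousOn

end Calculus

/-! ### The hypergeometric differential equation (DLMF 15.10.1) -/

section ODE

variable {a b c : ℂ}

/-- **The hypergeometric equation, DLMF 15.10.1**, for `f = ₂F₁(a,b;c;·)` with `c ∉ −ℕ`, on
`‖z‖ < 1`, written with the derivative formulas `f' = (ab/c) ₂F₁(a+1,b+1;c+1;·)`,
`f'' = (ab/c)((a+1)(b+1)/(c+1)) ₂F₁(a+2,b+2;c+2;·)`: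
`z(1−z) f'' + (c − (a+b+1)z) f' − ab f = 0`. [cite: DLMF, 15.10.1] -/
theorem ordinaryHypergeometric_ode (hc : ∀ n : ℕ, c ≠ -n) {z : ℂ} (hz : ‖z‖ < 1) :
    z * (1 - z) * (a * b / c * ((a + 1) * (b + 1) / (c + 1) * ₂F₁ (a + 2) (b + 2) (c + 2) z)) +
      (c - (a + b + 1) * z) * (a * b / c * ₂F₁ (a + 1) (b + 1) (c + 1) z) -
      a * b * ₂F₁ a b c z = 0 := by
  have hrec : ∀ n : ℕ, ((n : ℂ) + 1) * ((n : ℂ) + c) * ordinaryHypergeometricCoefficient a b c (n + 1) =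
      ((n : ℂ) + a) * ((n : ℂ) + b) * ordinaryHypergeometricCoefficient a b c n := by
    intro n
    have hcn : c + n ≠ 0 := fun h => hc n (by linear_combination h)
    linear_combination coeff_succ_rec a b c n hcn
  exact ode_of_hasSum hrec (hasSum_coeff_mul_pow hz) (hasSum_succ_coeff hz)
    (hasSum_succ_succ_coeff hz)

/-- **DLMF 15.10.1 in pointwise `HasDerivAt` form**: on `‖z‖ < 1`, with
`f' z = (ab/c) ₂F₁(a+1,b+1;c+1;z)` and `f'' z = (ab/c)((a+1)(b+1)/(c+1)) ₂F₁(a+2,b+2;c+2;z)`,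
`₂F₁ a b c` has derivative `f' z`, `f'` has derivative `f'' z`, and
`z(1−z) f'' z + (c − (a+b+1)z) f' z − ab ₂F₁(a,b;c;z) = 0` (`c ∉ −ℕ`). [cite: DLMF, 15.10.1] -/
theorem ordinaryHypergeometric_ode_hasDerivAt (hc : ∀ n : ℕ, c ≠ -n) {z : ℂ} (hz : ‖z‖ < 1) :
    HasDerivAt (₂F₁ a b c) (a * b / c * ₂F₁ (a + 1) (b + 1) (c + 1) z) z ∧
    HasDerivAt (fun w : ℂ => a * b / c * ₂F₁ (a + 1) (b + 1) (c + 1) w)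
      (a * b / c * ((a + 1) * (b + 1) / (c + 1) * ₂F₁ (a + 2) (b + 2) (c + 2) z)) z ∧
    z * (1 - z) * (a * b / c * ((a + 1) * (b + 1) / (c + 1) * ₂F₁ (a + 2) (b + 2) (c + 2) z)) +
      (c - (a + b + 1) * z) * (a * b / c * ₂F₁ (a + 1) (b + 1) (c + 1) z) -
      a * b * ₂F₁ a b c z = 0 := by
  refine ⟨hasDerivAt_ordinaryHypergeometric hz, ?_, ordinaryHypergeometric_ode hc hz⟩
  have h := (hasDerivAt_ordinaryHypergeometric (a := a + 1) (b := b + 1) (c := c + 1) hz).const_mul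
    (a * b / c)
  rw [show a + 1 + 1 = a + 2 by ring, show b + 1 + 1 = b + 2 by ring,
    show c + 1 + 1 = c + 2 by ring] at h
  exact h

/-- **The real-variable corollary in the variable `z = −x`** (the form of the near-extremal Kerr
throat equation): for complex `a b c` with `c ∉ −ℕ` and real `|x| < 1`, the function
`g x := ₂F₁(a,b;c;−x)` has `g'(x) = −f'(−x)`, `g''(x) = f''(−x)` (with `f', f''` as in
`ordinaryHypergeometric_ode_hasDerivAt`) and satisfies
`x(1+x) g'' + (c + (a+b+1)x) g' + ab g = 0`. [cite: DLMF, 15.10.1] -/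
theorem ordinaryHypergeometric_neg_ofReal_ode (hc : ∀ n : ℕ, c ≠ -n) {x : ℝ} (hx : |x| < 1) :
    HasDerivAt (fun y : ℝ => ₂F₁ a b c (-(y : ℂ)))
      (-(a * b / c * ₂F₁ (a + 1) (b + 1) (c + 1) (-(x : ℂ)))) x ∧
    HasDerivAt (fun y : ℝ => -(a * b / c * ₂F₁ (a + 1) (b + 1) (c + 1) (-(y : ℂ))))
      (a * b / c * ((a + 1) * (b + 1) / (c + 1) * ₂F₁ (a + 2) (b + 2) (c + 2) (-(x : ℂ)))) x ∧
    (x : ℂ) * (1 + x) *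
        (a * b / c * ((a + 1) * (b + 1) / (c + 1) * ₂F₁ (a + 2) (b + 2) (c + 2) (-(x : ℂ)))) +
      (c + (a + b + 1) * x) * (-(a * b / c * ₂F₁ (a + 1) (b + 1) (c + 1) (-(x : ℂ)))) +
      a * b * ₂F₁ a b c (-(x : ℂ)) = 0 := by
  have hz : ‖(-(x : ℂ))‖ < 1 := by rwa [norm_neg, Complex.norm_real, Real.norm_eq_abs]
  obtain ⟨h1, h2, h3⟩ := ordinaryHypergeometric_ode_hasDerivAt hc hz
  have hneg : HasDerivAt (fun y : ℝ => -(y : ℂ)) (-1) x := (hasDerivAt_neg (x : ℂ)).comp_ofReal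
  refine ⟨?_, ?_, ?_⟩
  · refine (h1.comp x hneg).congr_deriv ?_
    ring
  · refine ((h2.comp x hneg).neg).congr_deriv ?_
    ring
  · linear_combination (-1 : ℂ) * h3

end ODE

end Literature.Analysis.SpecialFunctions.Hypergeometric

end
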